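import Summits.HubbardSuperconductivity.HubbardSuperconductivity.Theorems.AnisotropyChordFourTorusKernelCertX

/-!
# Route `AnisotropyChord` / crux `ChordXY` at `M = 4`: kernel decisions for certificate matrices 0, 1
# (prover seat `hubbard-h0-rotor-p1` g18; one file per pair of matrices to respect the farm's per-file budget)
-/

set_option linter.style.longLine false
set_option linter.dupNamespace false
set_option autoImplicit false

namespace Summit.HubbardSuperconductivity.HubbardSuperconductivity.Theorems.AnisotropyChord.FourTorus

/-- certificate `0`: residual diagonally dominant, rows `< 29`. [folklore] -/
theorem certDomX_0_lo : certDomX 0 0 = true := by decide +kernel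
/-- certificate `0`: residual diagonally dominant, rows `≥ 29`. [folklore] -/
theorem certDomX_0_hi : certDomX 0 1 = true := by decide +kernel
/-- certificate `0`: the matrix is symmetric. [folklore] -/
theorem certSymX_0 : certSymX 0 = true := by decide +kernel
/-- certificate `1`: residual diagonally dominant, rows `< 29`. [folklore] -/
theorem certDomX_1_lo : certDomX 1 0 = true := by decide +kernel
/-- certificate `1`: residual diagonally dominant, rows `≥ 29`. [folklore] -/
theorem certDomX_1_hi : certDomX 1 1 = true := by decide +kernel
/-- certificate `1`: the matrix is symmetric. [folklore] -/
theorem certSymX_1 : certSymX 1 = true := by decide +kernel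

end Summit.HubbardSuperconductivity.HubbardSuperconductivity.Theorems.AnisotropyChord.FourTorus
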